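import Literature.Computability.AlgebraicComplexity.ValiantBooleanBridgeProofs
import Literature.Computability.AlgebraicComplexity.PermanentCodeTranscoder
import Literature.Computability.Complexity.PRelOfFunNSUBEXP
import HarnessLib

/-!
# Kabanets–Impagliazzo 2003, Lemma 3 for the permanent: discharge of `PRel_per01_subset_NSUBEXP_of_graph`

Sibling proof file of `ValiantBooleanBridgeProofs.lean` for its named fact
`Literature.Computability.AlgebraicComplexity.PRel_per01_subset_NSUBEXP_of_graph`
(Kabanets–Impagliazzo, STOC 2003, Lemma 3, p. 357 — "If `Perm ∈ NTIME(t)`, then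
`P^{Perm} ⊆ NTIME(poly(n) t(poly(n)))`" — in the instance of the proof of Thm. 18, p. 359:
`Perm ∈ NSUBEXP ⟹ P^{Perm} ⊆ NSUBEXP`), with `P^{Perm} = PRel (Oracle.ofFun per01Fn)` and
"`Perm ∈ NSUBEXP`" the membership of the graph language `permanent01Graph` (pairs
`⟨code of a 0/1 matrix, bin of its permanent⟩`, canonical codes).

The printed lemma has no printed proof ("Note that if `Perm ∈ NTIME(t)`, then `Perm ∈ coNTIME(t)`,
and so we obtain the following lemma"); the folklore argument — guess every oracle answer with its
certificate — is `PRel_ofFun_subset_NSUBEXP_of_fnGraph` (`Complexity/PRelOfFunNSUBEXP.lean`, on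
top of the verifier `mem_NSUBEXP_of_guardedBall` of `Complexity/NSUBEXPGuardedBall.lean`) for an
arbitrary polynomially bounded function oracle and its FULL graph `fnGraph g = {⟨u, bin (g u)⟩}`.
This file supplies the two facts about the permanent function `per01Fn` that close the gap:

* `fnGraph_per01Fn_mem_NSUBEXP`: `permanent01Graph ∈ NSUBEXP ⟹ fnGraph per01Fn ∈ NSUBEXP` — the full
  graph (over ALL query strings, which `per01Fn` reads through the junk-tolerant decoder of
  `encodingIntMatrix`) is the guarded ball of `permanent01Graph` along the polynomial-time
  CANONICALISATION `canonPerFn = toCodeFn ∘ toPlainFn` (the two transcoders of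
  `PermanentCodeTranscoder.lean`: every string is sent to the genuine code of a `0/1` matrix with
  the same `per01Fn` value, `canonPerFn_spec`), so that `⟨canonPerFn u, a⟩ ∈ permanent01Graph` iff
  `a = bin (per01Fn u)` (`boolPair_canonPerFn_mem_permanent01Graph_iff`); this is where the
  convention "`per01Fn = 0` on malformed queries" of the fact's docstring is absorbed by a
  polynomial-time map (`fnGraph_per01Fn_eq_guardedBall`);
* `length_encodeNat_per01Fn_le`: the values are polynomially long (`per01PlainFn_lt_two_pow` through
  the transcoder);
* **`PRel_per01_subset_NSUBEXP_of_graph_holds`**.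

## References

* V. Kabanets, R. Impagliazzo, *Derandomizing polynomial identity tests means proving circuit
  lower bounds*, STOC 2003, §2.1 and Lemma 3 (p. 357), proof of Thm. 18 (p. 359).
* L. G. Valiant, *The complexity of computing the permanent*, TCS 8 (1979), Thm. 1.
-/

noncomputable section

namespace Literature.Computability.AlgebraicComplexity

open _root_.Computability Complexity QuantumComplexity Brick Polynomial

/-! ### The canonical code of a query through the transcoders -/

/-- **The canonicalisation of permanent queries**: structured code → row-major word → structured
code (`toCodeFn ∘ toPlainFn`, `PermanentCodeTranscoder.lean`). [folklore] -/
def canonPerFn : List Bool → List Bool := toCodeFn ∘ toPlainFn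

/-- `canonPerFn ∈ FP`. [cite: AroraBarakCC2009, §1.3] -/
theorem canonPerFn_mem_FP : canonPerFn ∈ FP := comp_mem_FP toCodeFn_mem_FP toPlainFn_mem_FP

/-- The permanent function factors through its canonicalisation. [folklore] -/
theorem per01Fn_canonPerFn (u : List Bool) : per01Fn (canonPerFn u) = per01Fn u := by
  rw [canonPerFn, Function.comp_apply, per01Fn_toCodeFn, per01PlainFn_toPlainFn]

/-- **Every query is canonicalised to the genuine code of a `0/1` matrix with the same permanent
value.** [folklore] -/
theorem canonPerFn_spec (u : List Bool) :
    ∃ (n : ℕ) (M : Fin n → Fin n → ℤ), (∀ i j, M i j = 0 ∨ M i j = 1) ∧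
      canonPerFn u = encodingIntMatrix.encode ⟨n, M⟩ ∧ per01Fn u = ((Matrix.of M).permanent).toNat := by
  have key : ∀ (n : ℕ) (M : Fin n → Fin n → ℤ), (∀ i j, M i j = 0 ∨ M i j = 1) →
      canonPerFn u = encodingIntMatrix.encode ⟨n, M⟩ →
      ∃ (n : ℕ) (M : Fin n → Fin n → ℤ), (∀ i j, M i j = 0 ∨ M i j = 1) ∧
        canonPerFn u = encodingIntMatrix.encode ⟨n, M⟩ ∧ per01Fn u = ((Matrix.of M).permanent).toNat := by
    intro n M hM hc
    refine ⟨n, M, hM, hc, ?_⟩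
    rw [← per01Fn_canonPerFn, hc, per01Fn_encode M hM]
  have hc : canonPerFn u = toCodeSpec (toPlainFn u) := by rw [canonPerFn, Function.comp_apply, toCodeFn_apply]
  unfold toCodeSpec at hc
  split_ifs at hc with hsq
  · exact key _ _ (fun i j => by
      cases (toPlainFn u).getD (i.val * Nat.sqrt (toPlainFn u).length + j.val) false <;> simp) hc
  · exact key _ _ (fun _ _ => Or.inl rfl) hc

/-- **The graph language answers every query through the canonical code**:
`⟨canonPerFn u, a⟩ ∈ permanent01Graph ↔ a = bin (per01Fn u)`. [cite: KabanetsImpagliazzo2003, §2.1 (p. 357)] -/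
theorem boolPair_canonPerFn_mem_permanent01Graph_iff (u a : List Bool) :
    boolPair (canonPerFn u) a ∈ permanent01Graph ↔ a = encodeNat (per01Fn u) := by
  obtain ⟨n, M, hM, hc, hper⟩ := canonPerFn_spec u
  rw [hc, hper]
  constructor
  · rintro ⟨n', M', -, heq⟩
    have h2 := congr_arg (fun w => (boolUnpair w).2) heq
    have h1 := congr_arg (fun w => encodingIntMatrix.decode (boolUnpair w).1) heq
    simp only [boolUnpair_boolPair, encodingIntMatrix.decode_encode, Option.some.injEq] at h1 h2
    cases h1
    exact h2
  · rintro rfl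
    exact ⟨n, M, hM, rfl⟩

/-- **The permanent function has polynomially long values**: `|bin (per01Fn u)| ≤ s(|u|) + 1` for
an output-length bound `s` of the transcoder `toPlainFn` (`per01PlainFn w < 2^{|w|+1}`). [folklore] -/
theorem exists_length_encodeNat_per01Fn_le :
    ∃ s : Polynomial ℕ, ∀ u : List Bool, (encodeNat (per01Fn u)).length ≤ s.eval u.length := by
  obtain ⟨s, hs⟩ := exists_poly_length_le_of_mem_FP toPlainFn_mem_FP
  refine ⟨s + 1, fun u => ?_⟩
  rw [← per01PlainFn_toPlainFn, TM2Pass.length_encodeNat_eq_size, eval_add, eval_one]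
  exact (Nat.size_le.2 (per01PlainFn_lt_two_pow _)).trans (Nat.succ_le_succ (hs u))

/-! ### The full graph of the permanent function as a guarded ball of `permanent01Graph` -/

/-- The language of genuine pair codes `z = ⟨fstF z, sndF z⟩`. [folklore] -/
def RePair : Language Bool := {z | z = boolPair (fstF z) (sndF z)}

/-- `RePair ∈ P` (the string-equality test `eqPairFn`). [folklore] -/
theorem RePair_mem_P : RePair ∈ Classes.P :=
  mem_P_of_mem_FP (comp_mem_FP eqPairFn_mem_FP (fanoutFn_mem_FP OracleCompose.id_mem_FP (fanoutFn_mem_FP fstF_mem_FP sndF_mem_FP)))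
    _ fun z => by
      constructor
      · intro h
        rw [Function.comp_apply, fanoutFn_apply, fanoutFn_apply, eqPairFn_boolPair, id,
          decide_eq_true (show z = boolPair (fstF z) (sndF z) from h)]
      · intro h
        rw [Function.comp_apply, fanoutFn_apply, fanoutFn_apply, eqPairFn_boolPair, id,
          decide_eq_false (show ¬ z = boolPair (fstF z) (sndF z) from h)]

/-- **The guess language `R`** on `w = ⟨x, Y⟩`: `x` is a genuine pair `⟨u, a⟩`. [folklore] -/
def Rper : Language Bool := fstF ⁻¹' RePair

/-- `Rper ∈ P`. [folklore] -/
theorem Rper_mem_P : Rper ∈ Classes.P := preimage_mem_P RePair_mem_P fstF_mem_FP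

/-- **The guard `S`** on `v = ⟨⟨x, Y⟩, J⟩`: the same condition on `x` (every round of a good guess
queries). [folklore] -/
def Sper : Language Bool := (fstF ∘ fstF) ⁻¹' RePair

/-- `Sper ∈ P`. [folklore] -/
theorem Sper_mem_P : Sper ∈ Classes.P := preimage_mem_P RePair_mem_P (comp_mem_FP fstF_mem_FP fstF_mem_FP)

/-- **The query map `f`** on `v = ⟨⟨⟨u, a⟩, Y⟩, J⟩`: `⟨canonPerFn u, a⟩`. [folklore] -/
def fper : List Bool → List Bool := fanoutFn (canonPerFn ∘ fstF ∘ fstF ∘ fstF) (sndF ∘ fstF ∘ fstF)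

/-- `fper ∈ FP`. [folklore] -/
theorem fper_mem_FP : fper ∈ FP :=
  fanoutFn_mem_FP (comp_mem_FP canonPerFn_mem_FP (comp_mem_FP fstF_mem_FP (comp_mem_FP fstF_mem_FP fstF_mem_FP)))
    (comp_mem_FP sndF_mem_FP (comp_mem_FP fstF_mem_FP fstF_mem_FP))

/-- **The full graph of the permanent function is a guarded ball of `permanent01Graph`** (zero
guess length, genuine pairs, the query map `⟨canonPerFn u, a⟩`). [folklore] -/
theorem fnGraph_per01Fn_eq_guardedBall : fnGraph per01Fn = guardedBall permanent01Graph Rper Sper fper 0 := by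
  ext x
  rw [mem_guardedBall_iff]
  constructor
  · rintro ⟨u, rfl⟩
    have hre : boolPair u (encodeNat (per01Fn u)) ∈ RePair :=
      show boolPair u (encodeNat (per01Fn u)) =
        boolPair (fstF (boolPair u (encodeNat (per01Fn u)))) (sndF (boolPair u (encodeNat (per01Fn u)))) by simp
    refine ⟨[], by simp, ?_, fun j _ _ => ?_⟩
    · change fstF (boolPair (boolPair u (encodeNat (per01Fn u))) []) ∈ RePair
      rwa [fstF_boolPair]
    · show fper _ ∈ permanent01Graph
      simp only [fper, fanoutFn_apply, Function.comp_apply, fstF_boolPair, sndF_boolPair]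
      exact (boolPair_canonPerFn_mem_permanent01Graph_iff _ _).2 rfl
  · rintro ⟨Y, hY, hR, hall⟩
    obtain rfl : Y = [] := List.eq_nil_of_length_eq_zero (Nat.le_zero.1 (by simpa using hY))
    change fstF (boolPair x []) ∈ RePair at hR
    rw [fstF_boolPair] at hR
    have hx : x = boolPair (fstF x) (sndF x) := hR
    have h0 := hall 0 (by rw [length_boolPair]; omega)
      (by change (fstF ∘ fstF) _ ∈ RePair; simpa using hR)
    change fper _ ∈ permanent01Graph at h0
    simp only [fper, fanoutFn_apply, Function.comp_apply, fstF_boolPair, ones, List.replicate_zero] at h0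
    refine ⟨fstF x, hx.trans ?_⟩
    rw [(boolPair_canonPerFn_mem_permanent01Graph_iff _ _).1 h0]

/-- **`permanent01Graph ∈ NSUBEXP ⟹ fnGraph per01Fn ∈ NSUBEXP`** (the guarded ball, by
`mem_NSUBEXP_of_guardedBall`). [cite: KabanetsImpagliazzo2003, §2.1 (p. 357)] -/
theorem fnGraph_per01Fn_mem_NSUBEXP (h : permanent01Graph ∈ NSUBEXP) : fnGraph per01Fn ∈ NSUBEXP := by
  rw [fnGraph_per01Fn_eq_guardedBall]
  exact mem_NSUBEXP_of_guardedBall 0 h Rper_mem_P Sper_mem_P fper_mem_FP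

/-! ### The discharge -/

/-- **Kabanets–Impagliazzo 2003, Lemma 3 (discharged):** `permanent01Graph ∈ NSUBEXP ⟹
PRel (Oracle.ofFun per01Fn) ⊆ NSUBEXP` — the function-oracle lemma
`PRel_ofFun_subset_NSUBEXP_of_fnGraph` (guess the oracle answers with their certificates and
verify them, in the `NSUBEXP` verifier of `NSUBEXPGuardedBall.lean`) applied to the full graph of
the permanent function, which is in `NSUBEXP` as soon as `permanent01Graph` is
(`fnGraph_per01Fn_mem_NSUBEXP`), the values being polynomially long
(`exists_length_encodeNat_per01Fn_le`). [cite: KabanetsImpagliazzo2003, Lemma 3 (p. 357) and proof of Thm. 18 (p. 359)] -/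
theorem PRel_per01_subset_NSUBEXP_of_graph_holds : PRel_per01_subset_NSUBEXP_of_graph := fun h => by
  obtain ⟨s, hs⟩ := exists_length_encodeNat_per01Fn_le
  exact PRel_ofFun_subset_NSUBEXP_of_fnGraph hs (fnGraph_per01Fn_mem_NSUBEXP h)

end Literature.Computability.AlgebraicComplexity

end
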